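import Mathlib
import Summits.CriticalPhenomena.CardyFormulaZ2.Theorems.CardyMagicRigidityMagicFormulaTTwoPointGlue
import Summits.CriticalPhenomena.CardyFormulaZ2.Theorems.CardyMagicRigidityMagicFormulaTExistsLimitCoupling
import HarnessLib

/-!
# Truncation of the squared-phase power sum `A₂ = Σ_u θ_u²` at fixed mesh, and its UV bound
(crux `MagicFormulaT`, line `Sketch` v10, sub-goal `el_existsLimitA2_of_facts`) — part 2/3

Crux `Summit.CriticalPhenomena.CardyFormulaZ2.Theses.CardyMagicRigidity.MagicFormulaT`
(stmt-CriticalPhenomena-4836), line `Sketch`, skeleton v10, registered sub-goal `el_existsLimitA2_of_facts`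
(existence of `lim_{δ→0⁺} E_{1/2}[A₂]` modulo Camia–Newman + Smirnov–Werner).  With `θ_u = u.nestingPhase f`
over the honeycomb interface loops of `siteLoopConfig δ ω` under `triSitePercolation half` (the ensemble
`tEns`), `A₂ = Σ_u θ_u²` and its TRUNCATION `S_b = Σ_{u : diam u ≥ b} θ_u²` (a `finsum` over
`(siteLoopConfig δ ω).bigLoops b`), this file proves the fixed-mesh facts and the UV input of the Cauchy
argument (registered sub-goal `ela2_truncation`), and the uniform second moments (`ela2_sqMoment`):

* `ω ↦ S_b` is measurable (`FirstMoment.measurable_finsum_loops_sep`), `0 ≤ S_b ≤ A₂` pathwise at every mesh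
  `δ > 0` (`A₂ = S_b + Σ_{diam < b} θ_u²`, an identity of `finsum`s with finite supports: only the finitely
  many loops meeting `B̄(0,R)` carry a phase, `uva_finite_support_nestingPhase`), hence integrable
  (`A₂` is bounded at fixed mesh, `tp_powerSums_measurable_bounded`);
* (UV) for `0 < δ ≤ b ≤ 1`: `0 ≤ E[A₂] − E[S_b] = E Σ_{diam < b} θ_u² ≤ K_UV b²`, `K_UV = K₁ (πC)² (|R|+2)²`, by
  the band first-moment bound `stub_bandFirstMoment` applied to `g u = [diam u < b] θ_u²`
  (`|g u| ≤ (πC)² diam⁴`, `uva_band_dom_four`), after the index-set conversion `nf_finsum_band_eq_sum`;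
* (second moments) `E[A₂²] ≤ 2 E[exp A₂] ≤ B` for all small `δ` (`x² ≤ 2eˣ` for `x ≥ 0`,
  `Real.quadratic_le_exp_of_nonneg`; `ap_expMoment_powerSums`).

No named fact is used; no definition is introduced.  Helper names carry the prefix `ela2_`.
-/

noncomputable section

namespace Summit.CriticalPhenomena.CardyFormulaZ2.Cruxes.MagicFormulaT.LineSketch

open MeasureTheory Filter Set Metric
open scoped Real Topology BigOperators ENNReal
open Literature.Probability.RandomPlanarGeometry Literature.Probability.Percolation
  Literature.Probability.LatticeModels
open Summit.CriticalPhenomena.CardyFormulaZ2.Cruxes.NestingRigidity.RingCloudTomography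

/-! ## Fixed mesh: measurability, positivity, the split `A₂ = S_b + Σ_{diam<b} θ²`, integrability -/

section FixedMesh

variable {f : ℂ → ℝ} {R C : ℝ}

/-- `ω ↦ S_b(ω) = Σᶠ_{u ∈ bigLoops b} θ_u²` is measurable at every mesh. -/
theorem ela2_measurable_truncSum (f : ℂ → ℝ) (b δ : ℝ) :
    Measurable fun ω ↦ ∑ᶠ u ∈ (siteLoopConfig δ ω).bigLoops b, u.nestingPhase f ^ 2 :=
  FirstMoment.measurable_finsum_loops_sep tEns tEns_mem δ (fun u ↦ b ≤ diam u.range)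
    (fun u ↦ u.nestingPhase f ^ 2)

/-- `S_b ≥ 0`. -/
theorem ela2_truncSum_nonneg (f : ℂ → ℝ) (c : LoopConfig ℂ) (b : ℝ) :
    0 ≤ ∑ᶠ u ∈ c.bigLoops b, u.nestingPhase f ^ 2 :=
  finsum_nonneg fun _ ↦ finsum_nonneg fun _ ↦ sq_nonneg _

/-- `A₂ ≥ 0`. -/
theorem ela2_powerSum_nonneg (f : ℂ → ℝ) (c : LoopConfig ℂ) :
    0 ≤ ∑ᶠ u ∈ c.loops, u.nestingPhase f ^ 2 :=
  finsum_nonneg fun _ ↦ finsum_nonneg fun _ ↦ sq_nonneg _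

/-- **The split `A₂ = S_b + Σ_{diam < b} θ_u²` at a fixed mesh `δ > 0`**: an identity between `finsum`s with
finite supports (only the finitely many loops meeting `B̄(0, R)` carry a phase). -/
theorem ela2_powerSum_eq_truncSum_add (hR : ∀ z, R < ‖z‖ → f z = 0) (h0 : ∫ z, f z = 0) {δ : ℝ}
    (hδ : 0 < δ) (ω : SiteConfig (Site 2)) (b : ℝ) :
    ∑ᶠ u ∈ (siteLoopConfig δ ω).loops, u.nestingPhase f ^ 2 =
      (∑ᶠ u ∈ (siteLoopConfig δ ω).bigLoops b, u.nestingPhase f ^ 2) +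
        ∑ᶠ u ∈ {u ∈ (siteLoopConfig δ ω).loops | diam u.range < b}, u.nestingPhase f ^ 2 := by
  have hfs : ∀ Q : UnbasedLoop ℂ → Prop, ({u ∈ (siteLoopConfig δ ω).loops | Q u} ∩
      Function.support fun u : UnbasedLoop ℂ ↦ u.nestingPhase f ^ 2).Finite := fun Q ↦ by
    refine (uva_finite_support_nestingPhase tEns tEns_mem hδ hR h0 ω Q).subset ?_
    rintro u ⟨hu, hne⟩
    refine ⟨hu, fun h ↦ hne ?_⟩
    simp only [h, ne_eq, OfNat.ofNat_ne_zero, not_false_eq_true, zero_pow]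
  have hunion : (siteLoopConfig δ ω).bigLoops b ∪ {u ∈ (siteLoopConfig δ ω).loops | diam u.range < b} =
      (siteLoopConfig δ ω).loops := by
    ext u
    simp only [mem_union, LoopConfig.mem_bigLoops_iff, mem_setOf_eq]
    constructor
    · rintro (⟨hu, -⟩ | ⟨hu, -⟩) <;> exact hu
    · intro hu
      rcases le_or_gt b (diam u.range) with h | h
      · exact Or.inl ⟨hu, h⟩
      · exact Or.inr ⟨hu, h⟩
  have hdisj : Disjoint ((siteLoopConfig δ ω).bigLoops b)
      {u ∈ (siteLoopConfig δ ω).loops | diam u.range < b} := by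
    rw [Set.disjoint_left]
    rintro u ⟨-, h⟩ ⟨-, h'⟩
    exact absurd h (not_le.2 h')
  calc ∑ᶠ u ∈ (siteLoopConfig δ ω).loops, u.nestingPhase f ^ 2
      = ∑ᶠ u ∈ (siteLoopConfig δ ω).bigLoops b ∪ {u ∈ (siteLoopConfig δ ω).loops | diam u.range < b},
          u.nestingPhase f ^ 2 := by rw [hunion]
    _ = _ := finsum_mem_union' hdisj (hfs fun u ↦ b ≤ diam u.range) (hfs fun u ↦ diam u.range < b)

/-- `S_b ≤ A₂` at a fixed mesh `δ > 0`. -/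
theorem ela2_truncSum_le_powerSum (hR : ∀ z, R < ‖z‖ → f z = 0) (h0 : ∫ z, f z = 0) {δ : ℝ}
    (hδ : 0 < δ) (ω : SiteConfig (Site 2)) (b : ℝ) :
    ∑ᶠ u ∈ (siteLoopConfig δ ω).bigLoops b, u.nestingPhase f ^ 2 ≤
      ∑ᶠ u ∈ (siteLoopConfig δ ω).loops, u.nestingPhase f ^ 2 := by
  rw [ela2_powerSum_eq_truncSum_add hR h0 hδ ω b]
  exact le_add_of_nonneg_right (finsum_nonneg fun _ ↦ finsum_nonneg fun _ ↦ sq_nonneg _)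

/-- `S_b` is integrable at a fixed mesh `δ > 0` (measurable, and `0 ≤ S_b ≤ A₂ ≤ B₂`). -/
theorem ela2_integrable_truncSum (hC : ∀ z, |f z| ≤ C) (hR : ∀ z, R < ‖z‖ → f z = 0) (h0 : ∫ z, f z = 0)
    {δ : ℝ} (hδ : 0 < δ) (b : ℝ) :
    Integrable (fun ω ↦ ∑ᶠ u ∈ (siteLoopConfig δ ω).bigLoops b, u.nestingPhase f ^ 2)
      (triSitePercolation half) := by
  obtain ⟨-, -, -, ⟨B₂, -, hB₂⟩⟩ := tp_powerSums_measurable_bounded hC hR h0 hδ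
  refine Staircase.integrable_of_abs_le tEns_mem (ela2_measurable_truncSum f b δ) (B := B₂) fun ω ↦ ?_
  rw [abs_of_nonneg (ela2_truncSum_nonneg f _ b)]
  exact (ela2_truncSum_le_powerSum hR h0 hδ ω b).trans ((le_abs_self _).trans (hB₂ ω))

/-- `A₂` and `A₂²` are integrable at a fixed mesh `δ > 0`, with `A₂` measurable. -/
theorem ela2_integrable_powerSum (hC : ∀ z, |f z| ≤ C) (hR : ∀ z, R < ‖z‖ → f z = 0) (h0 : ∫ z, f z = 0)
    {δ : ℝ} (hδ : 0 < δ) :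
    (Measurable fun ω ↦ ∑ᶠ u ∈ (siteLoopConfig δ ω).loops, u.nestingPhase f ^ 2) ∧
    Integrable (fun ω ↦ ∑ᶠ u ∈ (siteLoopConfig δ ω).loops, u.nestingPhase f ^ 2) (triSitePercolation half) ∧
    Integrable (fun ω ↦ (∑ᶠ u ∈ (siteLoopConfig δ ω).loops, u.nestingPhase f ^ 2) ^ 2)
      (triSitePercolation half) := by
  obtain ⟨-, hm₂, -, ⟨B₂, -, hB₂⟩⟩ := tp_powerSums_measurable_bounded hC hR h0 hδ
  refine ⟨hm₂, Staircase.integrable_of_abs_le tEns_mem hm₂ hB₂,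
    Staircase.integrable_of_abs_le tEns_mem (hm₂.pow_const 2) (B := B₂ ^ 2) fun ω ↦ ?_⟩
  rw [abs_pow]
  exact pow_le_pow_left₀ (abs_nonneg _) (hB₂ ω) 2

end FixedMesh

/-! ## The UV bound: `E Σ_{diam < b} θ_u² ≤ K_UV b²` uniformly in `0 < δ ≤ b ≤ 1` -/

section UV

variable {f : ℂ → ℝ} {R C : ℝ}

/-- **Band first moment of the squared phases**: there is `K_UV ≥ 0` with, for `0 < δ ≤ b ≤ 1`,
`Σ_{u : diam u < b} θ_u²` integrable and `E Σ_{diam < b} θ_u² ≤ K_UV b²` (`stub_bandFirstMoment` with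
`g u = [diam u < b] θ_u²`, `|g| ≤ (πC)² diam⁴`, on the window `B(0, |R|+2)`; index-set conversion
`nf_finsum_band_eq_sum`). -/
theorem ela2_smallLoops (hC : ∀ z, |f z| ≤ C) (hR : ∀ z, R < ‖z‖ → f z = 0)
    (h0 : ∫ z, f z = 0) : ∃ KUV : ℝ, 0 ≤ KUV ∧ ∀ (b δ : ℝ), 0 < δ → δ ≤ b → b ≤ 1 →
    Integrable (fun ω ↦ ∑ᶠ u ∈ {u ∈ (siteLoopConfig δ ω).loops | diam u.range < b}, u.nestingPhase f ^ 2)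
      (triSitePercolation half) ∧
    ∫ ω, ∑ᶠ u ∈ {u ∈ (siteLoopConfig δ ω).loops | diam u.range < b}, u.nestingPhase f ^ 2
      ∂(triSitePercolation half) ≤ KUV * b ^ 2 := by
  have hC0 : 0 ≤ C := nonneg_of_abs_le hC
  obtain ⟨K₁, hK₁, hS2⟩ := stub_bandFirstMoment tEns tEns_mem
  refine ⟨K₁ * (π * C) ^ 2 * (|R| + 2) ^ 2, by positivity, fun b δ hδ hδb hb1 ↦ ?_⟩
  set D : Set ℂ := ball (0 : ℂ) (|R| + 2) with hDdef
  set g2 : UnbasedLoop ℂ → ℝ := fun u ↦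
    if 0 ≤ diam u.range ∧ diam u.range < b then u.nestingPhase f ^ 2 else 0 with hg2def
  have hbρ : b ≤ |R| + 2 := by linarith [abs_nonneg R]
  have hdom4 : ∀ u : UnbasedLoop ℂ, u.range ⊆ D → |g2 u| ≤ (π * C) ^ 2 * diam u.range ^ 4 :=
    fun u _ ↦ uva_band_dom_four hC hR 0 b u
  have hvan2 : ∀ u : UnbasedLoop ℂ, u.range ⊆ D → b ≤ diam u.range → g2 u = 0 :=
    fun u _ hbu ↦ uva_band_vanish hbu _
  have h := hS2 0 (|R| + 2) ((π * C) ^ 2) δ b D g2 hδ hδb hbρ (by positivity) subset_rfl hdom4 hvan2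
  -- the band statistic is the small-loop sum, pointwise
  have hpt : ∀ ω : SiteConfig (Site 2), (∑ᶠ u ∈ {u ∈ (tEns.X δ ω).loops | u.range ⊆ D}, g2 u) =
      ∑ᶠ u ∈ {u ∈ (siteLoopConfig δ ω).loops | diam u.range < b}, u.nestingPhase f ^ 2 := by
    intro ω
    have hfin := ConeTilt.finite_loops_meeting tEns tEns_mem hδ ω R
    have h1 := nf_finsum_band_eq_sum hR h0 hb1 hfin (fun x ↦ x ^ 2) (by norm_num)
    have h2 : ∑ᶠ u ∈ {u ∈ (tEns.X δ ω).loops | diam u.range < b}, u.nestingPhase f ^ 2 =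
        ∑ u ∈ hfin.toFinset with diam u.range < b, u.nestingPhase f ^ 2 := by
      refine finsum_mem_eq_sum_of_subset _ (fun u hu ↦ ?_) (fun u hu ↦ ?_)
      · rw [Finset.coe_filter, Set.mem_setOf_eq, Set.Finite.mem_toFinset]
        have hθ : u.nestingPhase f ≠ 0 := fun hz ↦ (Function.mem_support.1 hu.2) (by
          simp only [hz, ne_eq, OfNat.ofNat_ne_zero, not_false_eq_true, zero_pow])
        exact ⟨⟨hu.1.1, sw_meets_of_nestingPhase_ne_zero hR h0 hθ⟩, hu.1.2⟩
      · rw [Finset.coe_filter, Set.mem_setOf_eq, Set.Finite.mem_toFinset] at hu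
        exact ⟨hu.1.1, hu.2⟩
    exact h1.trans h2.symm
  refine ⟨h.1.congr (Eventually.of_forall hpt), ?_⟩
  calc ∫ ω, ∑ᶠ u ∈ {u ∈ (siteLoopConfig δ ω).loops | diam u.range < b}, u.nestingPhase f ^ 2
        ∂(triSitePercolation half)
      = ∫ ω, (∑ᶠ u ∈ {u ∈ (tEns.X δ ω).loops | u.range ⊆ D}, g2 u) ∂tEns.P :=
        (integral_congr_ae (Eventually.of_forall hpt)).symm
    _ ≤ ∫ ω, |∑ᶠ u ∈ {u ∈ (tEns.X δ ω).loops | u.range ⊆ D}, g2 u| ∂tEns.P :=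
        (le_abs_self _).trans abs_integral_le_integral_abs
    _ ≤ K₁ * (π * C) ^ 2 * (|R| + 2) ^ 2 * b ^ 2 := h.2

end UV

/-! ## Registered sub-goal: the truncation toolkit -/

/-- **Sub-goal `ela2_truncation` of line `Sketch` v10 (registered)**: the truncation `S_b = Σ_{diam ≥ b} θ_u²` of
the squared-phase power sum `A₂ = Σ_u θ_u²` at fixed mesh — measurable, integrable, `0 ≤ S_b ≤ A₂` — and the
UV bound `|E[A₂] − E[S_b]| ≤ K_UV b²` uniformly in `0 < δ ≤ b ≤ 1`.  See the module docstring. -/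
theorem ela2_truncation : ∀ (f : ℂ → ℝ) (R C : ℝ), Measurable f → (∀ z, |f z| ≤ C) →
    (∀ z, R < ‖z‖ → f z = 0) → ∫ z, f z = 0 →
    ∃ KUV : ℝ, 0 ≤ KUV ∧ ∀ (b δ : ℝ), 0 < δ → δ ≤ b → b ≤ 1 →
      (Measurable fun ω ↦ ∑ᶠ u ∈ (siteLoopConfig δ ω).bigLoops b, u.nestingPhase f ^ 2) ∧
      Integrable (fun ω ↦ ∑ᶠ u ∈ (siteLoopConfig δ ω).bigLoops b, u.nestingPhase f ^ 2)
        (triSitePercolation half) ∧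
      (∀ ω, 0 ≤ ∑ᶠ u ∈ (siteLoopConfig δ ω).bigLoops b, u.nestingPhase f ^ 2 ∧
        ∑ᶠ u ∈ (siteLoopConfig δ ω).bigLoops b, u.nestingPhase f ^ 2 ≤
          ∑ᶠ u ∈ (siteLoopConfig δ ω).loops, u.nestingPhase f ^ 2) ∧
      |(∫ ω, (∑ᶠ u ∈ (siteLoopConfig δ ω).loops, u.nestingPhase f ^ 2) ∂(triSitePercolation half)) -
          ∫ ω, (∑ᶠ u ∈ (siteLoopConfig δ ω).bigLoops b, u.nestingPhase f ^ 2) ∂(triSitePercolation half)| ≤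
        KUV * b ^ 2 := by
  intro f R C hf hC hR h0
  obtain ⟨KUV, hKUV, hUV⟩ := ela2_smallLoops hC hR h0
  refine ⟨KUV, hKUV, fun b δ hδ hδb hb1 ↦ ⟨ela2_measurable_truncSum f b δ, ela2_integrable_truncSum hC hR h0 hδ b,
    fun ω ↦ ⟨ela2_truncSum_nonneg f _ b, ela2_truncSum_le_powerSum hR h0 hδ ω b⟩, ?_⟩⟩
  obtain ⟨hIs, hEs⟩ := hUV b δ hδ hδb hb1
  have hIA := (ela2_integrable_powerSum hC hR h0 hδ (f := f)).2.1
  have hIS := ela2_integrable_truncSum hC hR h0 hδ b (f := f)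
  have hsub : (∫ ω, (∑ᶠ u ∈ (siteLoopConfig δ ω).loops, u.nestingPhase f ^ 2) ∂(triSitePercolation half)) -
      ∫ ω, (∑ᶠ u ∈ (siteLoopConfig δ ω).bigLoops b, u.nestingPhase f ^ 2) ∂(triSitePercolation half) =
      ∫ ω, ∑ᶠ u ∈ {u ∈ (siteLoopConfig δ ω).loops | diam u.range < b}, u.nestingPhase f ^ 2
        ∂(triSitePercolation half) := by
    rw [← integral_sub hIA hIS]
    refine integral_congr_ae (Eventually.of_forall fun ω ↦ ?_)
    simp only [ela2_powerSum_eq_truncSum_add hR h0 hδ ω b, add_sub_cancel_left]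
  rw [hsub, abs_of_nonneg (integral_nonneg fun ω ↦ finsum_nonneg fun _ ↦ finsum_nonneg fun _ ↦ sq_nonneg _)]
  exact hEs

/-! ## Uniform second moments of `A₂` -/

/-- **Uniform second moments of `A₂`**: there are `B ≥ 0` and `δ₀ > 0` with `A₂`, `A₂²` integrable and
`E[A₂²] ≤ B` for all `0 < δ < δ₀` (`A₂² ≤ 2 exp A₂` and `ap_expMoment_powerSums` at `s = 1`). -/
theorem ela2_sqMoment : ∀ (f : ℂ → ℝ) (R C : ℝ), Measurable f → (∀ z, |f z| ≤ C) →
    (∀ z, R < ‖z‖ → f z = 0) → ∫ z, f z = 0 → ∃ B δ₀ : ℝ, 0 ≤ B ∧ 0 < δ₀ ∧ ∀ δ : ℝ, 0 < δ → δ < δ₀ →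
      Integrable (fun ω ↦ ∑ᶠ u ∈ (siteLoopConfig δ ω).loops, u.nestingPhase f ^ 2) (triSitePercolation half) ∧
      Integrable (fun ω ↦ (∑ᶠ u ∈ (siteLoopConfig δ ω).loops, u.nestingPhase f ^ 2) ^ 2)
        (triSitePercolation half) ∧
      ∫ ω, (∑ᶠ u ∈ (siteLoopConfig δ ω).loops, u.nestingPhase f ^ 2) ^ 2 ∂(triSitePercolation half) ≤ B := by
  intro f R C hf hC hR h0
  obtain ⟨M, hM⟩ := ap_expMoment_powerSums f R C hf hC hR h0 1
  obtain ⟨δ₀, hδ₀, hM'⟩ := el_exists_Ioo_of_eventually hM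
  refine ⟨2 * |M|, δ₀, by positivity, hδ₀, fun δ hδ hδlt ↦ ?_⟩
  obtain ⟨-, -, hIe, hEe⟩ := hM' δ hδ hδlt
  obtain ⟨-, hIA, hIA2⟩ := ela2_integrable_powerSum hC hR h0 hδ (f := f)
  refine ⟨hIA, hIA2, ?_⟩
  have hpt : ∀ ω : SiteConfig (Site 2), (∑ᶠ u ∈ (siteLoopConfig δ ω).loops, u.nestingPhase f ^ 2) ^ 2 ≤
      2 * Real.exp (1 * ∑ᶠ u ∈ (siteLoopConfig δ ω).loops, u.nestingPhase f ^ 2) := fun ω ↦ by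
    rw [one_mul]
    have h := Real.quadratic_le_exp_of_nonneg (ela2_powerSum_nonneg f (siteLoopConfig δ ω))
    linarith [ela2_powerSum_nonneg f (siteLoopConfig δ ω)]
  calc ∫ ω, (∑ᶠ u ∈ (siteLoopConfig δ ω).loops, u.nestingPhase f ^ 2) ^ 2 ∂(triSitePercolation half)
      ≤ ∫ ω, 2 * Real.exp (1 * ∑ᶠ u ∈ (siteLoopConfig δ ω).loops, u.nestingPhase f ^ 2)
          ∂(triSitePercolation half) := integral_mono hIA2 (hIe.const_mul 2) hpt
    _ = 2 * ∫ ω, Real.exp (1 * ∑ᶠ u ∈ (siteLoopConfig δ ω).loops, u.nestingPhase f ^ 2)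
          ∂(triSitePercolation half) := integral_const_mul _ _
    _ ≤ 2 * M := by gcongr
    _ ≤ 2 * |M| := by gcongr; exact le_abs_self M

end Summit.CriticalPhenomena.CardyFormulaZ2.Cruxes.MagicFormulaT.LineSketch

end
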